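import Literature.Combinatorics.Optimization.CopositiveConeExtensionDegree
import Literature.Combinatorics.Optimization.MomentConeDegreeTwo
import Literature.Combinatorics.Optimization.CompletelyPositiveGraphs
import HarnessLib

/-!
# `sxd(CP_k^*) = k` for `k ≤ 4` and `sxd(CP_k) = k` for `k ≤ 2` (Averkov 2019, Cor. 16, the equality case)

G. Averkov, *Optimal size of linear matrix inequalities in semidefinite approaches to polynomial
optimization*, SIAM J. Appl. Algebra Geom. **3** (2019) = arXiv:1806.08656 [cite: Averkov2019] (held:
`paper:arxiv-1806.08656`; page locators of that text). Everything here is PROVED; no facts are asserted.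

**Corollary 16 (p06)**: "One has `sxd(CP_k) = sxd(CP_k^*) ≥ k`, and the equality
`sxd(CP_k) = sxd(CP_k^*) = k` holds if `k ≤ 4`." The lower bounds are `CopositiveConeExtensionDegree.lean`
(`CP_k`, the tree's `copositiveCone k` — `xᵀAx ≥ 0` on `ℝ^k_+`, symmetry not imposed) and
`MomentConeDegreeTwo.lean` (`CP_k^*`, the tree's `completelyPositiveCone k` — the closed convex cone generated
by the `xxᵀ`, `x ∈ ℝ^k_+`). Proof of the equality as printed (§5, p13): "It is known that
`CP_k = S^k_+ + N^k_+` holds for `k ≤ 4`, where `N^k_+ := S^k ∩ ℝ^{k×k}_+` … (see [MaxfieldMinc1962] and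
[Duer:2010]). Lemma 31 yields `sxd(CP_k) ≤ max{sxd(S^k_+), sxd(N^k_+)} = k`."

This file proves the matching UPPER bounds that the tree's material affords:

* §1 (every `k`): `S^k_+ + N^k_+ ⊆ CP_k` (`setOf_posSemidef_add_subset_copositiveCone`, with `N^k_+` the
  matrices whose symmetric part is entrywise nonnegative, matching the non-symmetric `copositiveCone`);
  `CP_k^*` is Berman's cone of completely positive matrices `{X | IsCp X}` (`CompletelyPsdRank.lean`:
  `X = BBᵀ`, `B ≥ 0`) — `completelyPositiveCone_eq_setOf_isCp` (uses the closedness `isClosed_setOf_isCp`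
  of `CompletelyPositiveGraphs.lean`); hence `CP_k^* ⊆ DNN_k` (doubly nonnegative = psd and entrywise
  nonnegative, the tree's `IsDnn`), and `DNN_k` has an `(S^k_+)^{k+1}`-lift (`hasBlockPsdLift_setOf_isDnn`:
  one block carries `X`, the diagonal of block `i + 1` carries row `i`).
* §2 (`k ≤ 4`, the dual half of Cor. 16 in full): by Maxfield–Minc (`IsDnn.isCp_fin_two/three/four` of
  `CompletelyPositiveGraphs.lean`) `CP_k^* = DNN_k` for `k ≤ 4`, so `CP_k^*` has an `(S^k_+)^{k+1}`-lift
  and **`isLeast_blockSize_hasBlockPsdLift_completelyPositiveCone_of_le_four`: `sxd(CP_k^*) = k`**.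
* §3 (`k ≤ 2`, the copositive half for small `k`): the classical order-two criterion — `A ∈ CP_2` iff
  `A₀₀, A₁₁ ≥ 0` and (`A₀₁ + A₁₀ ≥ 0` or `(A₀₁ + A₁₀)² ≤ 4A₀₀A₁₁`) — and `CP_2 = S^2_+ + N^2_+`
  (`copositiveCone_two_eq_posSemidef_add`), an explicit `(S^2_+)^3`-lift and
  **`isLeast_blockSize_hasBlockPsdLift_copositiveCone_two`: `sxd(CP_2) = 2`**; `CP_1 = CP_1^* = S^1_+`,
  `sxd = 1`.
* §4 (every `k`): `CP_k` is the dual cone of `CP_k^*` for the trace pairing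
  (`mem_copositiveCone_iff_forall_completelyPositiveCone`).

NOT here: `CP_k = S^k_+ + N^k_+` and `sxd(CP_k) = k` for `k = 3, 4` (Diananda's theorem; by cone duality it
is equivalent to the Maxfield–Minc theorem used in §2, but that route needs the closedness of
`S^k_+ + N^k_+` and the bipolar theorem, not in the tree), and the general duality `sxd(C) = sxd(C^*)`
((2.2), p06).
-/

noncomputable section

open Finset Matrix
open scoped MatrixOrder Pointwise

namespace Literature.Combinatorics.Optimization

open Literature.Combinatorics.Optimization.MotzkinStrausCopositive (IsCopositive)

/-! ### §1 `S^k_+ + N^k_+ ⊆ CP_k`, `CP_k^* = CP ⊆ DNN_k`, and the lift of `DNN_k` -/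

/-- **`S^k_+ + N^k_+ ⊆ CP_k`** for every `k`: a psd matrix plus a matrix with entrywise nonnegative
symmetric part is copositive (`xᵀ(P + N)x = xᵀPx + ½xᵀ(N + Nᵀ)x ≥ 0` on `ℝ^k_+`).
[cite: Averkov2019, proof of Cor. 16 (p13, "`CP_k = S^k_+ + N^k_+` holds for `k ≤ 4`")] -/
theorem setOf_posSemidef_add_subset_copositiveCone (k : ℕ) :
    {P : Matrix (Fin k) (Fin k) ℝ | P.PosSemidef} + {N : Matrix (Fin k) (Fin k) ℝ | ∀ i j, 0 ≤ N i j + N j i} ⊆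
      copositiveCone k := by
  rintro _ ⟨P, hP, N, hN, rfl⟩ x hx
  rw [add_mulVec, dotProduct_add]
  refine add_nonneg (by simpa using hP.dotProduct_mulVec_nonneg x) ?_
  have hT : x ⬝ᵥ Nᵀ *ᵥ x = x ⬝ᵥ N *ᵥ x := by
    rw [mulVec_transpose, dotProduct_comm, ← dotProduct_mulVec]
  have hS : 0 ≤ x ⬝ᵥ (N + Nᵀ) *ᵥ x := by
    simp only [dotProduct, mulVec, Matrix.add_apply, transpose_apply]
    exact sum_nonneg fun i _ => mul_nonneg (hx i) (sum_nonneg fun j _ => mul_nonneg (hN i j) (hx j))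
  rw [add_mulVec, dotProduct_add, hT] at hS
  linarith

namespace CopositiveSmall

/-- A property closed under the cone operations and limits holds on `CP_k^*` once it holds on the
generators `xxᵀ`, `x ≥ 0`. [folklore] -/
private theorem cp_induction {k : ℕ} {S : Set (Matrix (Fin k) (Fin k) ℝ)} (hS : IsClosed S)
    (hgen : ∀ x : Fin k → ℝ, (∀ i, 0 ≤ x i) → vecMulVec x x ∈ S) (h0 : (0 : Matrix (Fin k) (Fin k) ℝ) ∈ S)
    (hadd : ∀ P ∈ S, ∀ Q ∈ S, P + Q ∈ S) (hsmul : ∀ (c : ℝ), 0 ≤ c → ∀ P ∈ S, c • P ∈ S) :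
    completelyPositiveCone k ⊆ S := by
  refine closure_minimal (fun P hP => ?_) hS
  refine Submodule.span_induction (p := fun P _ => P ∈ S) ?_ h0 (fun P Q _ _ hP hQ => hadd P hP Q hQ)
    (fun c P _ hP => ?_) hP
  · rintro _ ⟨x, hx, rfl⟩; exact hgen x hx
  · exact hsmul c c.2 P hP

/-- `xxᵀ` is completely positive for `x ≥ 0` (one factor). [folklore] -/
private theorem isCp_vecMulVec_of_nonneg {k : ℕ} {x : Fin k → ℝ} (hx : ∀ i, 0 ≤ x i) :
    IsCp (vecMulVec x x) :=
  ⟨1, fun i _ => x i, fun i _ => hx i, fun i j => by simp [vecMulVec_apply]⟩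

/-- `0` is completely positive. [folklore] -/
private theorem isCp_zero_fin {k : ℕ} : IsCp (0 : Matrix (Fin k) (Fin k) ℝ) :=
  ⟨0, fun _ _ => 0, fun _ _ => le_rfl, fun i j => by simp⟩

/-- Sums of completely positive matrices are completely positive (concatenate the factorizations).
[folklore] -/
private theorem isCp_add_fin {k : ℕ} {X Y : Matrix (Fin k) (Fin k) ℝ} (hX : IsCp X) (hY : IsCp Y) :
    IsCp (X + Y) := by
  obtain ⟨d, p, hp, hpX⟩ := hX
  obtain ⟨e, q, hq, hqY⟩ := hY
  refine ⟨d + e, fun i => Fin.append (p i) (q i), fun i l => ?_, fun i j => ?_⟩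
  · refine Fin.addCases (fun l => ?_) (fun l => ?_) l
    · dsimp only
      rw [Fin.append_left]; exact hp i l
    · dsimp only
      rw [Fin.append_right]; exact hq i l
  · rw [Matrix.add_apply, hpX i j, hqY i j, Fin.sum_univ_add]
    simp only [Fin.append_left, Fin.append_right]

/-- Nonnegative multiples of completely positive matrices are completely positive. [folklore] -/
private theorem isCp_smul_fin {k : ℕ} {X : Matrix (Fin k) (Fin k) ℝ} (hX : IsCp X) {t : ℝ} (ht : 0 ≤ t) :
    IsCp (t • X) := by
  obtain ⟨d, P, hP0, hP⟩ := hX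
  refine ⟨d, fun i l => Real.sqrt t * P i l, fun i l => mul_nonneg (Real.sqrt_nonneg _) (hP0 i l),
    fun i j => ?_⟩
  have hs : Real.sqrt t * Real.sqrt t = t := Real.mul_self_sqrt ht
  rw [Matrix.smul_apply, hP i j, smul_eq_mul, Finset.mul_sum]
  refine Finset.sum_congr rfl fun l _ => ?_
  linear_combination (-(P i l * P j l)) * hs

end CopositiveSmall

open CopositiveSmall

/-- **`CP_k^*` is the cone of completely positive matrices**: the closed convex cone generated by the
`xxᵀ`, `x ∈ ℝ^k_+` (Averkov's `CP_k^*`) is `{BBᵀ : B ≥ 0 entrywise}` (the tree's `IsCp`; "elements of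
`CP_k^*` are called completely positive matrices", p06) — the latter is a closed convex cone containing the
generators (`isClosed_setOf_isCp`), and `BBᵀ = Σ_l b_l b_lᵀ`. [cite: Averkov2019, §2.1 (p06)] -/
theorem completelyPositiveCone_eq_setOf_isCp (k : ℕ) :
    completelyPositiveCone k = {X : Matrix (Fin k) (Fin k) ℝ | IsCp X} := by
  refine Set.Subset.antisymm
    (cp_induction isClosed_setOf_isCp (fun x hx => isCp_vecMulVec_of_nonneg hx) isCp_zero_fin
      (fun P hP Q hQ => isCp_add_fin hP hQ) (fun c hc P hP => isCp_smul_fin hP hc)) ?_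
  rintro X ⟨d, p, hp, hpX⟩
  have hX : X = ∑ l, vecMulVec (fun i => p i l) (fun i => p i l) := by
    ext i j
    rw [hpX i j, Matrix.sum_apply]
    simp [vecMulVec_apply]
  rw [hX]
  exact Finset.sum_induction _ (· ∈ completelyPositiveCone k) (fun a b ha hb => add_mem_completelyPositiveCone ha hb)
    (zero_mem_completelyPositiveCone k) (fun l _ => vecMulVec_mem_completelyPositiveCone fun i => hp i l)

/-- Completely positive matrices are entrywise nonnegative. [cite: Averkov2019, §2.1 (p06)] -/
theorem nonneg_apply_of_mem_completelyPositiveCone {k : ℕ} {P : Matrix (Fin k) (Fin k) ℝ}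
    (hP : P ∈ completelyPositiveCone k) (i j : Fin k) : 0 ≤ P i j := by
  rw [completelyPositiveCone_eq_setOf_isCp] at hP
  exact (IsCp.isCpsd hP).isDnn.2 i j

/-- **`CP_k^* ⊆ DNN_k`**: completely positive matrices are doubly nonnegative (psd and entrywise
nonnegative). [cite: Averkov2019, §2.1 (p06)] -/
theorem completelyPositiveCone_subset_setOf_isDnn (k : ℕ) :
    completelyPositiveCone k ⊆ {X : Matrix (Fin k) (Fin k) ℝ | IsDnn X} := fun _ hX =>
  ⟨posSemidef_of_mem_completelyPositiveCone hX, nonneg_apply_of_mem_completelyPositiveCone hX⟩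

namespace CopositiveSmall

/-- The linking subspace of the `DNN_k` lift: the diagonal of block `i + 1` repeats row `i` of block `0`.
[folklore] -/
private def dnnLink (k : ℕ) : Submodule ℝ (Fin (k + 1) → Matrix (Fin k) (Fin k) ℝ) where
  carrier := {M | ∀ i j, M i.succ j j = M 0 i j}
  add_mem' {M N} hM hN := fun i j => by simp only [Pi.add_apply, Matrix.add_apply, hM i j, hN i j]
  zero_mem' := fun i j => by simp
  smul_mem' c M hM := fun i j => by simp only [Pi.smul_apply, Matrix.smul_apply, hM i j]

/-- Membership in the linking subspace. [folklore] -/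
private theorem mem_dnnLink {k : ℕ} {M : Fin (k + 1) → Matrix (Fin k) (Fin k) ℝ} :
    M ∈ dnnLink k ↔ ∀ i j, M i.succ j j = M 0 i j := Iff.rfl

end CopositiveSmall

/-- **`DNN_k` has an `(S^k_+)^{k+1}`-lift**: `X ∈ DNN_k` iff there are psd blocks `M_0 = X` and
`M_{i+1}` with `diag(M_{i+1}) = (X_{i0}, …, X_{i,k-1})` (take `M_{i+1}` diagonal). Hence
`sxd(DNN_k) ≤ k`. [cite: Averkov2019, proof of Cor. 16 (p13, `sxd(N^k_+) ≤ k` via Lemma 31) and Def. 1 (p03)] -/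
theorem hasBlockPsdLift_setOf_isDnn (k : ℕ) :
    HasBlockPsdLift {X : Matrix (Fin k) (Fin k) ℝ | IsDnn X} k (k + 1) := by
  refine ⟨(dnnLink k).toAffineSubspace, LinearMap.proj 0, ?_⟩
  ext X
  constructor
  · rintro ⟨hX, hnn⟩
    refine ⟨Fin.cases X fun i => diagonal (X i), ⟨fun t => ?_, ?_⟩, rfl⟩
    · rcases Fin.eq_zero_or_eq_succ t with rfl | ⟨i, rfl⟩
      · simpa using hX
      · simp only [Fin.cases_succ]
        exact PosSemidef.diagonal fun j => hnn i j
    · rw [Submodule.mem_toAffineSubspace, mem_dnnLink]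
      intro i j
      simp
  · rintro ⟨M, ⟨hM, hL⟩, rfl⟩
    rw [Submodule.mem_toAffineSubspace, mem_dnnLink] at hL
    exact ⟨hM 0, fun i j => by rw [LinearMap.proj_apply, ← hL i j]; exact (hM i.succ).diag_nonneg⟩

/-! ### §2 `sxd(CP_k^*) = k` for `k ≤ 4` (Cor. 16, dual half) -/

/-- **Maxfield–Minc: `CP_k^* = DNN_k` for `k ≤ 4`** — doubly nonnegative matrices of order at most four
are completely positive (`IsDnn.isCp_fin_two/three/four` of `CompletelyPositiveGraphs.lean`; orders `0, 1`
directly). [cite: Averkov2019, proof of Cor. 16 (p13, "[MaxfieldMinc1962] and [Duer:2010]")] -/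
theorem completelyPositiveCone_eq_setOf_isDnn_of_le_four {k : ℕ} (hk : k ≤ 4) :
    completelyPositiveCone k = {X : Matrix (Fin k) (Fin k) ℝ | IsDnn X} := by
  refine Set.Subset.antisymm (completelyPositiveCone_subset_setOf_isDnn k) fun X hX => ?_
  rw [completelyPositiveCone_eq_setOf_isCp]
  change IsDnn X at hX
  change IsCp X
  obtain rfl | rfl | rfl | rfl | rfl : k = 0 ∨ k = 1 ∨ k = 2 ∨ k = 3 ∨ k = 4 := by omega
  · exact ⟨0, fun _ _ => 0, fun _ _ => le_rfl, fun i _ => Fin.elim0 i⟩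
  · refine ⟨1, fun _ _ => Real.sqrt (X 0 0), fun _ _ => Real.sqrt_nonneg _, fun i j => ?_⟩
    obtain rfl : i = 0 := Subsingleton.elim _ _
    obtain rfl : j = 0 := Subsingleton.elim _ _
    simp [Real.mul_self_sqrt (hX.2 0 0)]
  · exact hX.isCp_fin_two
  · exact hX.isCp_fin_three
  · exact hX.isCp_fin_four

/-- **`CP_k^*` has an `(S^k_+)^{k+1}`-lift for `k ≤ 4`** (`sxd(CP_k^*) ≤ k`).
[cite: Averkov2019, Cor. 16 (p06), proof §5 (p13)] -/
theorem hasBlockPsdLift_completelyPositiveCone_of_le_four {k : ℕ} (hk : k ≤ 4) :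
    HasBlockPsdLift (completelyPositiveCone k) k (k + 1) := by
  rw [completelyPositiveCone_eq_setOf_isDnn_of_le_four hk]
  exact hasBlockPsdLift_setOf_isDnn k

/-- **Averkov 2019, Corollary 16 (dual half, equality case): `sxd(CP_k^*) = k` for `k ≤ 4`** — `k` is
the least block size `K` for which the completely positive cone `CP_k^*` has an `(S^K_+)^m`-lift for some
`m` (lower bound: `MomentConeDegreeTwo.not_hasBlockPsdLift_completelyPositiveCone`).
[cite: Averkov2019, Cor. 16 (p06)] -/
theorem isLeast_blockSize_hasBlockPsdLift_completelyPositiveCone_of_le_four {k : ℕ} (hk : k ≤ 4) :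
    IsLeast {K : ℕ | ∃ m : ℕ, HasBlockPsdLift (completelyPositiveCone k) K m} k :=
  ⟨⟨k + 1, hasBlockPsdLift_completelyPositiveCone_of_le_four hk⟩,
    mem_lowerBounds_blockSize_hasBlockPsdLift_completelyPositiveCone k⟩

/-! ### §3 The copositive cone of order `≤ 2` -/

namespace CopositiveSmall

/-- `yᵀMy` for a `2 × 2` matrix. [folklore] -/
private theorem quadForm_two (M : Matrix (Fin 2) (Fin 2) ℝ) (y : Fin 2 → ℝ) :
    y ⬝ᵥ (M *ᵥ y) = M 0 0 * y 0 * y 0 + (M 0 1 + M 1 0) * y 0 * y 1 + M 1 1 * y 1 * y 1 := by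
  simp [dotProduct, mulVec, Fin.sum_univ_two]
  ring

/-- A real `2 × 2` matrix is positive semidefinite iff it is symmetric with nonnegative diagonal and
nonnegative determinant. [folklore] -/
private theorem psd_two_iff (M : Matrix (Fin 2) (Fin 2) ℝ) :
    M.PosSemidef ↔ M 1 0 = M 0 1 ∧ 0 ≤ M 0 0 ∧ 0 ≤ M 1 1 ∧ M 0 1 ^ 2 ≤ M 0 0 * M 1 1 := by
  rw [posSemidef_iff_dotProduct_mulVec]
  constructor
  · rintro ⟨hH, hq⟩
    have hsym : M 1 0 = M 0 1 := by
      have := congrFun (congrFun hH 0) 1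
      simpa [conjTranspose_apply] using this
    have hq' : ∀ y : Fin 2 → ℝ, 0 ≤ M 0 0 * y 0 * y 0 + 2 * M 0 1 * y 0 * y 1 + M 1 1 * y 1 * y 1 := by
      intro y
      have h := hq y
      rw [star_trivial, quadForm_two, hsym] at h
      linarith
    have h00 : 0 ≤ M 0 0 := by simpa using hq' ![1, 0]
    have h11 : 0 ≤ M 1 1 := by simpa using hq' ![0, 1]
    refine ⟨hsym, h00, h11, ?_⟩
    rcases h00.lt_or_eq with hpos | hzero
    · have h := hq' ![M 0 1, -M 0 0]
      simp only [Matrix.cons_val_zero, Matrix.cons_val_one] at h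
      nlinarith
    · rw [← hzero, zero_mul]
      suffices h : M 0 1 = 0 by rw [h]; norm_num
      by_contra hne
      set c : ℝ := 1 / (|M 1 1| + 1) with hc
      have hcpos : 0 < c := by rw [hc]; positivity
      have h := hq' ![1, -(c * M 0 1)]
      simp only [Matrix.cons_val_zero, Matrix.cons_val_one, ← hzero] at h
      have hsq : 0 < M 0 1 ^ 2 := by positivity
      have hM11 : M 1 1 * c ≤ 1 := by
        rw [hc]
        rw [mul_one_div, div_le_one (by positivity)]
        linarith [le_abs_self (M 1 1)]
      have hfac : (0 : ℝ) * 1 * 1 + 2 * M 0 1 * 1 * -(c * M 0 1) + M 1 1 * -(c * M 0 1) * -(c * M 0 1) =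
          c * M 0 1 ^ 2 * (M 1 1 * c - 2) := by ring
      rw [hfac] at h
      have hneg : c * M 0 1 ^ 2 * (M 1 1 * c - 2) < 0 :=
        mul_neg_of_pos_of_neg (mul_pos hcpos hsq) (by linarith)
      linarith
  · rintro ⟨hsym, h00, h11, hdet⟩
    refine ⟨?_, fun y => ?_⟩
    · ext i j
      fin_cases i <;> fin_cases j <;> simp [conjTranspose_apply, hsym]
    · rw [star_trivial, quadForm_two, hsym]
      rcases h00.lt_or_eq with hpos | hzero
      · have h1 : M 0 0 * (M 0 0 * y 0 * y 0 + (M 0 1 + M 0 1) * y 0 * y 1 + M 1 1 * y 1 * y 1) =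
            (M 0 0 * y 0 + M 0 1 * y 1) ^ 2 + (M 0 0 * M 1 1 - M 0 1 ^ 2) * y 1 ^ 2 := by ring
        have h2 : 0 ≤ (M 0 0 * y 0 + M 0 1 * y 1) ^ 2 + (M 0 0 * M 1 1 - M 0 1 ^ 2) * y 1 ^ 2 := by
          have : 0 ≤ (M 0 0 * M 1 1 - M 0 1 ^ 2) * y 1 ^ 2 := mul_nonneg (by linarith) (sq_nonneg _)
          positivity
        rw [← h1] at h2
        exact nonneg_of_mul_nonneg_right h2 hpos
      · have hs : M 0 1 = 0 := by
          rw [← hzero, zero_mul] at hdet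
          exact pow_eq_zero_iff (n := 2) (by norm_num) |>.mp (le_antisymm hdet (sq_nonneg _))
        rw [← hzero, hs]
        nlinarith [sq_nonneg (y 1)]

end CopositiveSmall

/-- **The copositive matrices of order two**: `A ∈ CP_2` iff `A₀₀ ≥ 0`, `A₁₁ ≥ 0` and the symmetrised
off-diagonal entry `b = (A₀₁ + A₁₀)/2` satisfies `b ≥ -√(A₀₀A₁₁)`, i.e. `b ≥ 0` or `b² ≤ A₀₀A₁₁` (the case
`k = 2` of `CP_k = S^k_+ + N^k_+`; if `b < 0` and `b² > ac`, `x = (-b, a)` resp. `x = (c + 1, -2b)` when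
`a = 0` gives `xᵀAx < 0`). [cite: Averkov2019, proof of Cor. 16 (p13, `CP_k = S^k_+ + N^k_+` for `k ≤ 4`)] -/
theorem mem_copositiveCone_two_iff (A : Matrix (Fin 2) (Fin 2) ℝ) :
    A ∈ copositiveCone 2 ↔
      0 ≤ A 0 0 ∧ 0 ≤ A 1 1 ∧ (0 ≤ A 0 1 + A 1 0 ∨ (A 0 1 + A 1 0) ^ 2 ≤ 4 * (A 0 0 * A 1 1)) := by
  rw [mem_copositiveCone_iff]
  constructor
  · intro hA
    have q : ∀ y : Fin 2 → ℝ, (∀ i, 0 ≤ y i) →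
        0 ≤ A 0 0 * y 0 * y 0 + (A 0 1 + A 1 0) * y 0 * y 1 + A 1 1 * y 1 * y 1 := fun y hy => by
      rw [← quadForm_two]; exact hA y hy
    have h00 : 0 ≤ A 0 0 := by
      simpa using q ![1, 0] (fun i => by fin_cases i <;> simp)
    have h11 : 0 ≤ A 1 1 := by
      simpa using q ![0, 1] (fun i => by fin_cases i <;> simp)
    refine ⟨h00, h11, ?_⟩
    rw [or_iff_not_imp_left, not_le]
    intro hs
    by_contra hlt
    rw [not_le] at hlt
    rcases h00.eq_or_lt with ha | ha
    · have h := q ![A 1 1 + 1, -(A 0 1 + A 1 0)] (fun i => by fin_cases i <;> simp <;> linarith)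
      simp only [Matrix.cons_val_zero, Matrix.cons_val_one] at h
      rw [← ha] at h
      nlinarith [mul_pos_of_neg_of_neg hs hs]
    · have h := q ![-(A 0 1 + A 1 0), 2 * A 0 0] (fun i => by fin_cases i <;> simp <;> linarith)
      simp only [Matrix.cons_val_zero, Matrix.cons_val_one] at h
      nlinarith [mul_pos ha (sub_pos.2 hlt)]
  · rintro ⟨h00, h11, h⟩ y hy
    rw [quadForm_two]
    have hy0 := hy 0
    have hy1 := hy 1
    rcases h with hs | hdet
    · have h1 : 0 ≤ A 0 0 * y 0 * y 0 := mul_nonneg (mul_nonneg h00 hy0) hy0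
      have h2 : 0 ≤ (A 0 1 + A 1 0) * y 0 * y 1 := mul_nonneg (mul_nonneg hs hy0) hy1
      have h3 : 0 ≤ A 1 1 * y 1 * y 1 := mul_nonneg (mul_nonneg h11 hy1) hy1
      linarith
    · rcases h00.eq_or_lt with ha | ha
      · have hs0 : A 0 1 + A 1 0 = 0 := by
          rw [← ha, zero_mul, mul_zero] at hdet
          exact pow_eq_zero_iff (n := 2) (by norm_num) |>.mp (le_antisymm hdet (sq_nonneg _))
        rw [← ha, hs0]
        have h3 : 0 ≤ A 1 1 * y 1 * y 1 := mul_nonneg (mul_nonneg h11 hy1) hy1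
        linarith
      · have key : 4 * A 0 0 * (A 0 0 * y 0 * y 0 + (A 0 1 + A 1 0) * y 0 * y 1 + A 1 1 * y 1 * y 1) =
            (2 * A 0 0 * y 0 + (A 0 1 + A 1 0) * y 1) ^ 2 + (4 * (A 0 0 * A 1 1) - (A 0 1 + A 1 0) ^ 2) * y 1 ^ 2 := by
          ring
        have hnn : 0 ≤ (2 * A 0 0 * y 0 + (A 0 1 + A 1 0) * y 1) ^ 2 +
            (4 * (A 0 0 * A 1 1) - (A 0 1 + A 1 0) ^ 2) * y 1 ^ 2 :=
          add_nonneg (sq_nonneg _) (mul_nonneg (sub_nonneg.2 hdet) (sq_nonneg _))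
        rw [← key] at hnn
        exact nonneg_of_mul_nonneg_right hnn (by positivity)

/-- **`CP_2` by a psd certificate**: `A ∈ CP_2` iff there is a psd `P` with the same diagonal as `A` and
`2P₀₁ ≤ A₀₁ + A₁₀` (i.e. `A - P ∈ N^2_+`). [cite: Averkov2019, proof of Cor. 16 (p13)] -/
theorem mem_copositiveCone_two_iff_exists_posSemidef (A : Matrix (Fin 2) (Fin 2) ℝ) :
    A ∈ copositiveCone 2 ↔ ∃ P : Matrix (Fin 2) (Fin 2) ℝ,
      P.PosSemidef ∧ P 0 0 = A 0 0 ∧ P 1 1 = A 1 1 ∧ 2 * P 0 1 ≤ A 0 1 + A 1 0 := by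
  rw [mem_copositiveCone_two_iff]
  constructor
  · rintro ⟨h00, h11, h⟩
    rcases le_or_gt 0 (A 0 1 + A 1 0) with hs | hs
    · refine ⟨!![A 0 0, 0; 0, A 1 1], ?_, by simp, by simp, by simpa using hs⟩
      exact (psd_two_iff _).2 ⟨by simp, by simpa using h00, by simpa using h11, by simpa using mul_nonneg h00 h11⟩
    · have hdet : (A 0 1 + A 1 0) ^ 2 ≤ 4 * (A 0 0 * A 1 1) := h.resolve_left (not_le.2 hs)
      refine ⟨!![A 0 0, (A 0 1 + A 1 0) / 2; (A 0 1 + A 1 0) / 2, A 1 1], ?_, by simp, by simp, ?_⟩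
      · refine (psd_two_iff _).2 ⟨by simp, by simpa using h00, by simpa using h11, ?_⟩
        simp only [of_apply, cons_val_zero, cons_val_one]
        nlinarith [hdet]
      · simp only [of_apply, cons_val_zero, cons_val_one]
        linarith
  · rintro ⟨P, hP, h0, h1, h2⟩
    obtain ⟨-, hp0, hp1, hdet⟩ := (psd_two_iff P).1 hP
    refine ⟨h0 ▸ hp0, h1 ▸ hp1, ?_⟩
    rw [or_iff_not_imp_left, not_le, ← h0, ← h1]
    intro hs
    nlinarith [mul_nonneg (sub_nonneg.2 h2) (by linarith : (0 : ℝ) ≤ -(A 0 1 + A 1 0) - 2 * P 0 1), hdet]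

/-- **`CP_2 = S^2_+ + N^2_+`** (Maxfield–Minc / Diananda at order two, in the tree's non-symmetric
convention: `N^2_+` = matrices with entrywise nonnegative symmetric part).
[cite: Averkov2019, proof of Cor. 16 (p13, "`CP_k = S^k_+ + N^k_+` holds for `k ≤ 4`")] -/
theorem copositiveCone_two_eq_posSemidef_add :
    copositiveCone 2 =
      {P : Matrix (Fin 2) (Fin 2) ℝ | P.PosSemidef} + {N : Matrix (Fin 2) (Fin 2) ℝ | ∀ i j, 0 ≤ N i j + N j i} := by
  refine Set.Subset.antisymm (fun A hA => ?_) (setOf_posSemidef_add_subset_copositiveCone 2)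
  obtain ⟨P, hP, h0, h1, h2⟩ := (mem_copositiveCone_two_iff_exists_posSemidef A).1 hA
  have hsym : P 1 0 = P 0 1 := ((psd_two_iff P).1 hP).1
  refine ⟨P, hP, A - P, fun i j => ?_, add_sub_cancel P A⟩
  fin_cases i <;> fin_cases j <;> simp [Matrix.sub_apply] <;> linarith

namespace CopositiveSmall

/-- The projection of the `CP_2` lift: `π(M₀, M₁, M₂) = [[M₀₀₀, M₀₀₁ + M₁₀₀ + M₂₀₀ - M₂₁₁],
[M₀₀₁ + M₁₀₀ - M₂₀₀ + M₂₁₁, M₀₁₁]]` (`M₀` the psd part, `M₁₀₀` the slack of `2P₀₁ ≤ A₀₁ + A₁₀`,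
`M₂₀₀ - M₂₁₁` the skew part). [folklore] -/
private def copTwoLiftMap : (Fin 3 → Matrix (Fin 2) (Fin 2) ℝ) →ₗ[ℝ] Matrix (Fin 2) (Fin 2) ℝ where
  toFun M := !![M 0 0 0, M 0 0 1 + M 1 0 0 + M 2 0 0 - M 2 1 1;
    M 0 0 1 + M 1 0 0 - M 2 0 0 + M 2 1 1, M 0 1 1]
  map_add' M N := by
    ext i j
    fin_cases i <;> fin_cases j <;> simp <;> ring
  map_smul' c M := by
    ext i j
    fin_cases i <;> fin_cases j <;> simp <;> ring

/-- Unfolding of the projection `π`. [folklore] -/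
private theorem copTwoLiftMap_apply (M : Fin 3 → Matrix (Fin 2) (Fin 2) ℝ) :
    copTwoLiftMap M = !![M 0 0 0, M 0 0 1 + M 1 0 0 + M 2 0 0 - M 2 1 1;
      M 0 0 1 + M 1 0 0 - M 2 0 0 + M 2 1 1, M 0 1 1] := rfl

end CopositiveSmall

/-- **`CP_2` has an `(S^2_+)^3`-lift** (`sxd(CP_2) ≤ 2`): `A ∈ CP_2` iff `A = π(M₀, M₁, M₂)` for psd
`2 × 2` blocks, `π` as in `copTwoLiftMap` — `M₀` is the psd certificate of
`mem_copositiveCone_two_iff_exists_posSemidef`, `(M₁)₀₀ ≥ 0` the slack, `(M₂)₀₀ - (M₂)₁₁` the skew part of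
`A`. [cite: Averkov2019, Cor. 16 (p06), proof §5 (p13, Lemma 31 with `sxd(S^2_+) = sxd(N^2_+) = 2`)] -/
theorem hasBlockPsdLift_copositiveCone_two : HasBlockPsdLift (copositiveCone 2) 2 3 := by
  refine ⟨⊤, copTwoLiftMap, ?_⟩
  ext A
  rw [mem_copositiveCone_two_iff_exists_posSemidef]
  constructor
  · rintro ⟨P, hP, h0, h1, h2⟩
    have hsym : P 1 0 = P 0 1 := ((psd_two_iff P).1 hP).1
    set B₁ : Matrix (Fin 2) (Fin 2) ℝ := !![(A 0 1 + A 1 0) / 2 - P 0 1, 0; 0, 0] with hB₁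
    set B₂ : Matrix (Fin 2) (Fin 2) ℝ := !![max ((A 0 1 - A 1 0) / 2) 0, 0; 0, max (-((A 0 1 - A 1 0) / 2)) 0]
      with hB₂
    have hB₁psd : B₁.PosSemidef := by
      refine (psd_two_iff _).2 ⟨by simp [hB₁], ?_, by simp [hB₁], by simp [hB₁]⟩
      simp only [hB₁, of_apply, cons_val_zero]
      linarith
    have hB₂psd : B₂.PosSemidef := by
      refine (psd_two_iff _).2 ⟨by simp [hB₂], ?_, ?_, ?_⟩
      · simp only [hB₂, of_apply, cons_val_zero]
        exact le_max_right _ _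
      · simp only [hB₂, of_apply, cons_val_zero, cons_val_one]
        exact le_max_right _ _
      · simp only [hB₂, of_apply, cons_val_zero, cons_val_one]
        nlinarith [le_max_right ((A 0 1 - A 1 0) / 2) 0, le_max_right (-((A 0 1 - A 1 0) / 2)) 0]
    refine ⟨![P, B₁, B₂], ⟨fun t => ?_, AffineSubspace.mem_top ℝ _ _⟩, ?_⟩
    · fin_cases t
      · exact hP
      · exact hB₁psd
      · exact hB₂psd
    · have hk := max_zero_sub_max_neg_zero_eq_self ((A 0 1 - A 1 0) / 2)
      rw [copTwoLiftMap_apply]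
      ext i j
      fin_cases i <;> fin_cases j <;> simp [h0, h1, hB₁, hB₂] <;> linarith
  · rintro ⟨M, ⟨hM, -⟩, rfl⟩
    refine ⟨M 0, hM 0, by simp [copTwoLiftMap_apply], by simp [copTwoLiftMap_apply], ?_⟩
    have h1 : 0 ≤ M 1 0 0 := (hM 1).diag_nonneg
    simp only [copTwoLiftMap_apply, of_apply, cons_val', cons_val_zero, cons_val_one]
    linarith

/-- **Averkov 2019, Corollary 16 (equality case `k = 2`): `sxd(CP_2) = 2`** — `2` is the least block size
`K` for which `CP_2` has an `(S^K_+)^m`-lift for some `m` (lower bound: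
`not_hasBlockPsdLift_copositiveCone`). [cite: Averkov2019, Cor. 16 (p06)] -/
theorem isLeast_blockSize_hasBlockPsdLift_copositiveCone_two :
    IsLeast {K : ℕ | ∃ m : ℕ, HasBlockPsdLift (copositiveCone 2) K m} 2 :=
  ⟨⟨3, hasBlockPsdLift_copositiveCone_two⟩, mem_lowerBounds_blockSize_hasBlockPsdLift_copositiveCone 2⟩

/-- `S^1_+ = {a ≥ 0}`. [folklore] -/
private theorem setOf_posSemidef_fin_one_eq :
    {A : Matrix (Fin 1) (Fin 1) ℝ | A.PosSemidef} = {A | 0 ≤ A 0 0} := by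
  ext A
  refine ⟨fun h => h.diag_nonneg, fun h => ?_⟩
  refine PosSemidef.of_dotProduct_mulVec_nonneg (Matrix.IsHermitian.ext fun i j => ?_) fun x => ?_
  · obtain rfl : i = 0 := Subsingleton.elim _ _
    obtain rfl : j = 0 := Subsingleton.elim _ _
    simp
  · have hq : star x ⬝ᵥ A *ᵥ x = A 0 0 * (x 0 * x 0) := by
      simp [dotProduct, mulVec]
      ring
    rw [hq]
    exact mul_nonneg h (mul_self_nonneg _)

/-- **`CP_1 = S^1_+`** (`= {a ≥ 0}`). [cite: Averkov2019, proof of Cor. 16 (p13, "the trivial case `k = 1`")] -/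
theorem copositiveCone_one_eq : copositiveCone 1 = {A : Matrix (Fin 1) (Fin 1) ℝ | A.PosSemidef} := by
  rw [setOf_posSemidef_fin_one_eq]
  ext A
  rw [mem_copositiveCone_iff]
  constructor
  · intro hA
    have h := hA (fun _ => 1) (fun _ => zero_le_one)
    have hq : (fun _ => (1 : ℝ)) ⬝ᵥ A *ᵥ (fun _ => 1) = A 0 0 := by simp [dotProduct, mulVec]
    rwa [hq] at h
  · intro hA x hx
    have hq : x ⬝ᵥ A *ᵥ x = A 0 0 * (x 0 * x 0) := by
      simp [dotProduct, mulVec]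
      ring
    rw [hq]
    exact mul_nonneg hA (mul_self_nonneg _)

/-- **`CP_1^* = S^1_+`**. [cite: Averkov2019, proof of Cor. 16 (p13, "the trivial case `k = 1`")] -/
theorem completelyPositiveCone_one_eq :
    completelyPositiveCone 1 = {A : Matrix (Fin 1) (Fin 1) ℝ | A.PosSemidef} := by
  rw [setOf_posSemidef_fin_one_eq]
  refine Set.Subset.antisymm (fun P hP => nonneg_apply_of_mem_completelyPositiveCone hP 0 0) fun A hA => ?_
  have hAe : A = A 0 0 • vecMulVec (fun _ : Fin 1 => (1 : ℝ)) (fun _ => 1) := by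
    ext i j
    obtain rfl : i = 0 := Subsingleton.elim _ _
    obtain rfl : j = 0 := Subsingleton.elim _ _
    simp [vecMulVec_apply]
  rw [hAe]
  exact smul_mem_completelyPositiveCone (vecMulVec_mem_completelyPositiveCone fun _ => zero_le_one) hA

/-- **`sxd(CP_1) = 1`**. [cite: Averkov2019, Cor. 16 (p06)] -/
theorem isLeast_blockSize_hasBlockPsdLift_copositiveCone_one :
    IsLeast {K : ℕ | ∃ m : ℕ, HasBlockPsdLift (copositiveCone 1) K m} 1 :=
  ⟨⟨1, by rw [copositiveCone_one_eq]; exact SpectraplexNeighborly.hasBlockPsdLift_posSemidef_self 1⟩,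
    mem_lowerBounds_blockSize_hasBlockPsdLift_copositiveCone 1⟩

/-- **`sxd(CP_1^*) = 1`**. [cite: Averkov2019, Cor. 16 (p06)] -/
theorem isLeast_blockSize_hasBlockPsdLift_completelyPositiveCone_one :
    IsLeast {K : ℕ | ∃ m : ℕ, HasBlockPsdLift (completelyPositiveCone 1) K m} 1 :=
  isLeast_blockSize_hasBlockPsdLift_completelyPositiveCone_of_le_four (by norm_num)

/-! ### §4 `CP_k` is the dual cone of `CP_k^*` -/

/-- **`CP_k = (CP_k^*)^*`** for the trace pairing `⟨A, X⟩ = Σ A_{ij}X_{ij}`: `A` is copositive iff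
`⟨A, X⟩ ≥ 0` for every `X` in the closed convex cone generated by the `xxᵀ`, `x ≥ 0` (`⟨A, xxᵀ⟩ = xᵀAx`;
the pairing is continuous and linear in `X`). [cite: Averkov2019, §2.1 (p06, "its dual cone `CP_k^*`")] -/
theorem mem_copositiveCone_iff_forall_completelyPositiveCone {k : ℕ} (A : Matrix (Fin k) (Fin k) ℝ) :
    A ∈ copositiveCone k ↔ ∀ X ∈ completelyPositiveCone k, 0 ≤ ∑ i, ∑ j, A i j * X i j := by
  have hform : ∀ x : Fin k → ℝ, ∑ i, ∑ j, A i j * vecMulVec x x i j = x ⬝ᵥ A *ᵥ x := fun x => by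
    simp only [dotProduct, mulVec, vecMulVec_apply, mul_sum]
    exact sum_congr rfl fun i _ => sum_congr rfl fun j _ => by ring
  constructor
  · intro hA
    refine cp_induction (S := {X | 0 ≤ ∑ i, ∑ j, A i j * X i j}) ?_ (fun x hx => ?_) (by simp) ?_ ?_
    · exact isClosed_le continuous_const (continuous_finsetSum _ fun i _ => continuous_finsetSum _
        fun j _ => continuous_const.mul ((continuous_apply j).comp (continuous_apply i)))
    · show 0 ≤ ∑ i, ∑ j, A i j * vecMulVec x x i j
      rw [hform]
      exact hA x hx
    · intro P hP Q hQ
      show 0 ≤ ∑ i, ∑ j, A i j * (P + Q) i j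
      simp only [Matrix.add_apply, mul_add, sum_add_distrib]
      exact add_nonneg hP hQ
    · intro c hc P hP
      show 0 ≤ ∑ i, ∑ j, A i j * (c • P) i j
      have : ∑ i, ∑ j, A i j * (c • P) i j = c * ∑ i, ∑ j, A i j * P i j := by
        simp only [Matrix.smul_apply, smul_eq_mul, mul_sum]
        exact sum_congr rfl fun i _ => sum_congr rfl fun j _ => by ring
      rw [this]
      exact mul_nonneg hc hP
  · intro h x hx
    rw [← hform]
    exact h _ (vecMulVec_mem_completelyPositiveCone hx)

end Literature.Combinatorics.Optimization
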